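import Literature.AlgebraicGeometry.ModuliOfAbelianVarieties.SiegelFamilyProductLociMumfordTateGroup
import Literature.AlgebraicGeometry.ModuliOfAbelianVarieties.SiegelFamilyProductLociHodgeGroupEllipticBlock
import Literature.AlgebraicGeometry.ModuliOfAbelianVarieties.SiegelFamilyHumbertSquareInvariant
import Literature.NumberTheory.ComplexMultiplication.SiegelCMPointsDegreeOneMumfordTateGroup
import Literature.Geometry.Kaehler.ComplexTorusHodgeClassesProductHodgeGroupComplexPoints
import HarnessLib

/-!
# The Mumford–Tate group on the product locus `𝔥_{g₁} × 𝔥_{g₂} → 𝔥_g` as the FIBRE PRODUCT OVER THE MULTIPLIER: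
# `MT(X_{(Z₁ 0; 0 Z₂)}) = MT(X_{Z₁}) ×_{𝔾_m} MT(X_{Z₂})` exactly when `Hg(X_{Z₁} × X_{Z₂}) = Hg(X_{Z₁}) × Hg(X_{Z₂})`
# (Moonen 1999 (1.11)/(1.13)/(1.14), Moonen 2004 (5.2), Gordon Lemma 2.7), and `= GL₂ ×_{det = ν} MT(X_Z)` on
# `𝔥₁ × 𝔥_n → 𝔥_{1+n}` for a NON-CM elliptic block and a CM-type block (Moonen–Zarhin §3 Theorem (2))

Layer `Literature/AlgebraicGeometry/ModuliOfAbelianVarieties`, namespace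
`Literature.AlgebraicGeometry.ModuliOfAbelianVarieties.SiegelModuli`; lane `lit-hodgefound` (Track 2 foundations
library, Layer A1 «Mumford–Tate groups of the members of the Siegel family»), prover seat p17, generation 31,
self-proposed row g31-#1 — the EQUALITY CRITERION behind g30-#11 (`SiegelFamilyProductLociMumfordTateGroup`: on p11's
product locus `MT(X_{(Z₁ 0; 0 Z₂)}) ⊆ {reindex_ε (A 0; 0 B) : A ∈ MT(X_{Z₁}), B ∈ MT(X_{Z₂}), det(A)^{2g₂} = det(B)^{2g₁}}`)
and g30-#13 (two non-isogenous ELLIPTIC blocks: `det A = det B` is attained).  The members `X_Z` of the Siegel family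
are PRINCIPALLY POLARISED (`isRiemannForm_prinForm`, Gram matrix `−J` on the symplectic lattice basis,
`latticeGram_prinForm`), so every element of `MT(X_Z)(ℝ) ⊆ GSp_{2g}(ℝ)` has a MULTIPLIER `ν` (`ᵗA J A = ν J`) and the
Kaehler layer's extended Mumford–Tate group `M̃T(X) ⊂ GL(V ⊕ ℚ(1))` (`ComplexTorusExtendedMumfordTateGroup`, Moonen (5.2):
`M̃T(X)(ℝ)` is the graph of `ν` on `MT(X)(ℝ)`) reads on the Siegel family as the pairs `(A, ν(A))` (§1).  On the product
locus the multipliers of the two blocks of an element of `MT(X_{(Z₁ 0; 0 Z₂)})(ℝ)` always AGREE (Gordon's Lemma 2.7 on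
`E_{Z₁} ⊞ E_{Z₂}`; this sharpens g30-#11's determinant relation, §2), and the Kaehler layer's criterion
(`ComplexTorusMumfordTateGroupProductEllipticCurves` §1: in `GL(V₁) × GL(V₂) × 𝔾_m` the central factor is counted ONCE, so
`MT(X₁ × X₂) = MT(X₁) ×_{𝔾_m} MT(X₂)` over the multiplier characters iff `Hg(X₁ × X₂)(ℂ) = Hg(X₁)(ℂ) × Hg(X₂)(ℂ)`), moved
to the coordinates `(λ, μ)` of `𝔥_g` by g30-#11's `reindex_ε` transport and fed with the REAL-points equality of the
Hodge groups through the density theorem `IsRiemannForm.hodgeGroupC_prod_eq_of_hodgeGroup_prod_eq` (p17 gen 14), gives the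
fibre product (§2).  §3 is the unconditional instance `𝔥₁ × 𝔥_n`: `τ ∈ 𝔥₁` NOT a CM point (`MT(X_τ) = GL₂`, g30-#12) and
`Z ∈ 𝔥_n` of CM type (`Hg(X_Z)(ℂ)` commutative, equivalently `MT(X_Z)` a torus — skel-A3), where g30-#9 supplies
`Hg(X_τ × X_Z) = Hg(X_τ) × Hg(X_Z)`.  THEOREMS ONLY: no definition, no instance, no named fact, nothing conditional (D-0026,
net debt 0).

## Sources, verbatim

* B. Moonen, *An introduction to Mumford–Tate groups* (2004), §5 (5.2) (p. 11): «we find that `MT^♯(X) ⊂ MT(X) × 𝔾_m ⊂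
  CSp(V, φ) × 𝔾_m` is the graph of the multiplier character `ν : CSp(V, φ) → 𝔾_m` restricted to `MT(X)`»; §4 Lemma 4.6 /
  Remark («`MT(V₁ ⊕ V₂) ⊂ MT(V₁) × MT(V₂)` … the projections are surjective»); §5 (5.6) Exercise (p. 12).
* B. Moonen, *Notes on Mumford–Tate groups* (1999), (1.11): «`MT(V)` is the almost direct product (inside `GL(V)`) of
  `𝔾_{m,ℚ}` and `Hg(V)`»; (1.13) Remark: «`Hg(V) ⊆ Hg(V₁) × Hg(V₂)`. This need not be an equality … For the Mumford-Tate group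
  similar statements hold, but note that `MT(V)` is almost never equal to `MT(V₁) × MT(V₂)`, as the central factor
  `𝔾_m = 𝔾_m · id` is counted twice in `MT(V₁) × MT(V₂)`»; (1.14).
* B. B. Gordon, *A survey of the Hodge conjecture for abelian varieties* (1997), §2 Lemma 2.7 (`MT(A) ⊆ GSp` preserves every
  polarisation up to the same character).
* B. Moonen, Yu. Zarhin, *Hodge classes on abelian varieties of low dimension*, Math. Ann. 315 (1999) 711–733 (held text
  `paper:arxiv-math_9901113`), §3 Theorem (Hazama) (2) (chunk p0006 L70–L76): «Suppose `X₁` has no factors of Type IV and `X₂`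
  is of CM-type. Then … `Hg(X₁ × X₂) = Hg(X₁) × Hg(X₂)`.»
* J. Carlson, S. Müller-Stach, C. Peters, *Period Mappings and Period Domains* (2nd ed. 2017), §15.2 Problem 15.2.3 (a),
  Examples 15.2.4 (ii): «if `C` has no complex multiplication … `MT(H¹(C)) = GL(2)`».
* H. Lange, *Abelian Varieties over the Complex Numbers* (2023), §3.1.1 Prop. 3.1.1 and (3.1) (the symplectic basis of
  `X_Z`, `E_Z = Im (Im Z)⁻¹`).

## What is proved (`e : Fin g₁ ⊕ Fin g₂ ≃ Fin g`, `ε` with g30-#3's compatibilities `h₁–h₄`, `Zᵢ ∈ 𝔥_{gᵢ}`, `gᵢ ≥ 1`)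

* §1 **`extGL_mem_extMumfordTateGroup_prinPeriod_iff`**: `(A, t) ∈ M̃T(X_Z)(ℝ) ⟺ A ∈ MT(X_Z)(ℝ) ∧ ᵗA J A = t J` (Moonen (5.2)
  on the Siegel family); `extGL_mem_extMumfordTateGroupC_prinPeriod_iff` (complex points);
  `exists_transpose_mul_J_mul_eq_smul_of_mem_mumfordTateGroup_prinPeriod` (every `A ∈ MT(X_Z)(ℝ)` has a multiplier
  `ν ∈ ℝ^×`: `MT ⊆ GSp_{2g}`).
* §2 **`exists_extGL_mem_of_mem_mumfordTateGroup_prinPeriod_blockDiagPoint`** (ALWAYS: every `N ∈ MT(X_{(Z₁ 0; 0 Z₂)})(ℝ)` is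
  `reindex_ε (A 0; 0 B)` with `(A, t) ∈ M̃T(X_{Z₁})(ℝ)`, `(B, t) ∈ M̃T(X_{Z₂})(ℝ)` for a COMMON `t ∈ ℝ^×` — Gordon's Lemma 2.7;
  `exists_common_multiplier_of_mem_mumfordTateGroup_prinPeriod_blockDiagPoint`: `ᵗA J A = t J`, `ᵗB J B = t J`);
  **`mem_mumfordTateGroup_prinPeriod_blockDiagPoint_iff_exists_extGL_of_hodgeGroup_prod_eq`** and
  **`mem_mumfordTateGroup_prinPeriod_blockDiagPoint_iff_of_hodgeGroup_prod_eq`** (WHEN `Hg(X_{Z₁} × X_{Z₂})(ℝ) = Hg(X_{Z₁})(ℝ) × Hg(X_{Z₂})(ℝ)`: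
  `N ∈ MT(X_{(Z₁ 0; 0 Z₂)})(ℝ) ⟺ N = reindex_ε (A 0; 0 B)` with `A ∈ MT(X_{Z₁})(ℝ)`, `B ∈ MT(X_{Z₂})(ℝ)` of the SAME multiplier —
  `MT = MT(X_{Z₁}) ×_{𝔾_m} MT(X_{Z₂})`); `…C…` (complex points);
  **`extMumfordTateGroup_prod_prinPeriod_eq_of_hodgeGroup_prod_eq`** (`M̃T(X_{Z₁} × X_{Z₂})(ℝ) = M̃T(X_{Z₁})(ℝ) ×_{ℝ^×} M̃T(X_{Z₂})(ℝ)`: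
  EQUALITY in Moonen's (1.13) for `M̃T`); **`extMumfordTateGroupC_prod_prinPeriod_eq_iff_hodgeGroup_prod_eq`** (on complex points
  the `M̃T` equality holds IFF the real Hodge groups multiply).
* §3 (`τ = Z₁ ∈ 𝔥₁` not a CM point, `Z = Z₂ ∈ 𝔥_n` with `Hg(X_Z)(ℂ)` commutative, `n ≥ 1`)
  `hodgeGroupC_prod_prinPeriod_one_eq_of_not_isCMPoint` (`Hg(X_τ × X_Z)(ℂ) = Hg(X_τ)(ℂ) × Hg(X_Z)(ℂ)`, the complex points of g30-#9),
  **`mem_mumfordTateGroup_prinPeriod_blockDiagPoint_iff_of_not_isCMPoint`**: `N ∈ MT(X_{(τ 0; 0 Z)})(ℝ) ⟺ N = reindex_ε (A 0; 0 B)`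
  with `A ∈ GL(ℝ^{λ¹, μ¹})` ARBITRARY, `B ∈ MT(X_Z)(ℝ)` and `ᵗB J B = det(A) J` — **`MT(X_{(τ 0; 0 Z)}) = GL₂ ×_{det = ν} MT(X_Z)`**
  (`…_of_isTorusSubgroup`; `reindex_fromBlocks_mem_mumfordTateGroup_prinPeriod_blockDiagPoint_of_not_isCMPoint`;
  `mem_mumfordTateGroupC_prinPeriod_blockDiagPoint_iff_of_not_isCMPoint` on complex points), and
  **`extMumfordTateGroup_prod_prinPeriod_one_eq_of_not_isCMPoint`** (`M̃T(X_τ × X_Z)(ℝ) = M̃T(X_τ)(ℝ) ×_{ℝ^×} M̃T(X_Z)(ℝ)`).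

## Proof route / deviation

Everything is the Kaehler layer by name: Moonen (5.2) (`IsRiemannForm.extGL_mem_extMumfordTateGroup_iff`) with `G = −J`;
Gordon 2.7 (`exists_common_multiplier_of_blockDiagGL_mem_mumfordTateGroup_prod`); the criterion
`blockDiagGL_mem_mumfordTateGroup_prod_iff_of_forall_blockDiagC_mem` / `…C…`, whose complex-points hypothesis is produced from the
real equality by density (`IsRiemannForm.hodgeGroupC_prod_eq_of_hodgeGroup_prod_eq`); g30-#11's `reindex_ε` transports
`mem_mumfordTateGroup(C)_prinPeriod_blockDiagPoint_iff`; for §3, g30-#9's `hodgeGroup_prod_prinPeriod_one_eq_of_not_isCMPoint`,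
g30-#12's `mumfordTateGroup(C)_prinPeriod_one_eq_top_of_not_isCMPoint` and the `2 × 2` identity `ᵗA J A = det(A) J`.  Not
restated: g30-#13 (two elliptic blocks, `det A = det B`), g30-#11's strictness witnesses, g30-#10's scalar curve.

## References

* [Moonen2004MT] B. Moonen, *An introduction to Mumford–Tate groups* (2004), §5 (5.2), §4 Lemma 4.6, §5 (5.6).
  [cite: Moonen2004MT, §5 (5.2) (p. 11)]
* [Moonen1999MTNotes] B. Moonen, *Notes on Mumford–Tate groups* (1999), (1.11), (1.13), (1.14). [cite: Moonen1999MTNotes, (1.13)]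
* [Gordon1997] B. B. Gordon, *A survey of the Hodge conjecture for abelian varieties* (1997), §2 Lemma 2.7, Prop. 2.12.
  [cite: Gordon1997, §2 Lemma 2.7]
* [MoonenZarhin1999LowDim] B. Moonen, Yu. Zarhin, *Hodge classes on abelian varieties of low dimension*, Math. Ann. 315
  (1999), 711–733, §3 Theorem (2), (3.1). [cite: MoonenZarhin1999LowDim, §3 Theorem (2) (p0006 L70–L76)]
* [CarlsonMullerStachPeters2017] J. Carlson, S. Müller-Stach, C. Peters, *Period Mappings and Period Domains*, §15.2
  Problem 15.2.3 (a), Examples 15.2.4 (ii). [cite: CarlsonMullerStachPeters2017, §15.2 Examples 15.2.4 (ii)]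
* [Lange2023AbelianVarietiesComplex] H. Lange, *Abelian Varieties over the Complex Numbers*, Springer (2023), §3.1.1
  Prop. 3.1.1 and (3.1). [cite: Lange2023AbelianVarietiesComplex, §3.1.1 Prop. 3.1.1]
-/

noncomputable section

open scoped Matrix Classical
open Matrix Function Set Module

namespace Literature.AlgebraicGeometry.ModuliOfAbelianVarieties

namespace SiegelModuli

open Literature.NumberTheory.Automorphic
open Literature.NumberTheory.ModularForms Literature.NumberTheory.ModularForms.SiegelUpperHalfSpace
open Literature.NumberTheory.ComplexMultiplication Literature.NumberTheory.ComplexMultiplication.SiegelCMPoint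
open Literature.Geometry.Kaehler Literature.Geometry.Kaehler.ComplexTorus

variable {g g₁ g₂ n : ℕ}

/-! ## §0 Two matrix identities -/

section Identities

/-- `ᵗA (−J) A = t • (−J) ⟺ ᵗA J A = t • J`. [folklore] -/
private theorem transpose_mul_neg_mul_eq_smul_neg_iff {R α : Type*} [CommRing R] [Fintype α] (A G : Matrix α α R)
    (t : R) : Aᵀ * (-G) * A = t • (-G) ↔ Aᵀ * G * A = t • G := by
  rw [Matrix.mul_neg, Matrix.neg_mul, smul_neg, neg_inj]

/-- **`ᵗA J A = det(A) · J` for a `2 × 2` matrix on `Fin 1 ⊕ Fin 1`** (`GSp₂ = GL₂`, `ν = det`).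
[cite: Lange2023AbelianVarietiesComplex, §3.2.3 Exercise (1) (p. 167)] -/
private theorem transpose_mul_J_mul_fin_one {R : Type*} [CommRing R] (A : Matrix (Fin 1 ⊕ Fin 1) (Fin 1 ⊕ Fin 1) R) :
    Aᵀ * Matrix.J (Fin 1) R * A = A.det • Matrix.J (Fin 1) R := by
  have h0 : ((finSumFinEquiv (m := 1) (n := 1)).symm 0 : Fin 1 ⊕ Fin 1) = Sum.inl 0 := by decide
  have h1 : ((finSumFinEquiv (m := 1) (n := 1)).symm 1 : Fin 1 ⊕ Fin 1) = Sum.inr 0 := by decide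
  have hdet : A.det = A (Sum.inl 0) (Sum.inl 0) * A (Sum.inr 0) (Sum.inr 0) -
      A (Sum.inl 0) (Sum.inr 0) * A (Sum.inr 0) (Sum.inl 0) := by
    rw [← Matrix.det_reindex_self (finSumFinEquiv (m := 1) (n := 1)) A, Matrix.det_fin_two]
    simp [h0, h1]
  ext i j
  rcases i with i | i <;> rcases j with j | j <;>
    rw [Subsingleton.elim i 0, Subsingleton.elim j 0] <;>
    simp [Matrix.J, Matrix.mul_apply, Fintype.sum_sum_type, Matrix.fromBlocks, hdet] <;> ring

end Identities

/-! ## §1 Moonen (5.2) on the Siegel family: `M̃T(X_Z)(ℝ) = {(A, ν(A)) : A ∈ MT(X_Z)(ℝ)}`, `ᵗA J A = ν(A) J` -/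

section Multiplier

variable (Z : siegelUpperHalfSpace g)

/-- **MOONEN (5.2) ON THE SIEGEL FAMILY, REAL POINTS: `(A, t) ∈ M̃T(X_Z)(ℝ) ⟺ A ∈ MT(X_Z)(ℝ)` and `ᵗA J A = t · J`** (`g ≥ 1`):
the extended Mumford–Tate group of the principally polarised `X_Z` is the graph of the multiplier character on `MT(X_Z)`,
the multiplier being read on the symplectic lattice basis `(λ, μ)` where the Gram matrix of `E_Z` is `−J`.
[cite: Moonen2004MT, §5 (5.2) (p. 11)] [cite: Moonen1999MTNotes, (1.14)] [cite: Lange2023AbelianVarietiesComplex, §3.1.1 Prop. 3.1.1 and (3.1)] -/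
theorem extGL_mem_extMumfordTateGroup_prinPeriod_iff (hg : 0 < g) {A : GL (Fin g ⊕ Fin g) ℝ} {t : ℝˣ} :
    extGL (Fin g ⊕ Fin g) ℝ (A, t) ∈ extMumfordTateGroup (prinPeriod Z) ↔
      A ∈ mumfordTateGroup (prinPeriod Z) ∧
        (A : Matrix (Fin g ⊕ Fin g) (Fin g ⊕ Fin g) ℝ)ᵀ * Matrix.J (Fin g) ℝ * A = (t : ℝ) • Matrix.J (Fin g) ℝ := by
  haveI : Nonempty (Fin g ⊕ Fin g) := ⟨Sum.inl ⟨0, hg⟩⟩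
  rw [(isRiemannForm_prinForm Z).extGL_mem_extMumfordTateGroup_iff, latticeGram_prinForm,
    transpose_mul_neg_mul_eq_smul_neg_iff]

/-- **The same on COMPLEX points: `(A, c) ∈ M̃T(X_Z)(ℂ) ⟺ A ∈ MT(X_Z)(ℂ)` and `ᵗA J A = c · J`** (`g ≥ 1`).
[cite: Moonen2004MT, §5 (5.2) (p. 11)] [cite: Moonen1999MTNotes, (1.14)] -/
theorem extGL_mem_extMumfordTateGroupC_prinPeriod_iff (hg : 0 < g) {A : GL (Fin g ⊕ Fin g) ℂ} {c : ℂˣ} :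
    extGL (Fin g ⊕ Fin g) ℂ (A, c) ∈ extMumfordTateGroupC (prinPeriod Z) ↔
      A ∈ mumfordTateGroupC (prinPeriod Z) ∧
        (A : Matrix (Fin g ⊕ Fin g) (Fin g ⊕ Fin g) ℂ)ᵀ * Matrix.J (Fin g) ℂ * A = (c : ℂ) • Matrix.J (Fin g) ℂ := by
  haveI : Nonempty (Fin g ⊕ Fin g) := ⟨Sum.inl ⟨0, hg⟩⟩
  have hη := isRiemannForm_prinForm Z
  rw [ComplexTorus.extGL_mem_extMumfordTateGroupC_iff hη.1 hη.exists_ratMatrix_latticeGram hη.latticeGram_ne_zero,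
    latticeGram_prinForm, Matrix.map_neg _ (map_neg Complex.ofRealHom), Matrix.map_J,
    transpose_mul_neg_mul_eq_smul_neg_iff]

/-- **`MT(X_Z)(ℝ) ⊆ GSp_{2g}(ℝ)`: every `A ∈ MT(X_Z)(ℝ)` has a multiplier `ν ∈ ℝ^×`, `ᵗA J A = ν J`, and then
`(A, ν) ∈ M̃T(X_Z)(ℝ)`** (`g ≥ 1`). [cite: Moonen2004MT, §5 (5.2) ("`MT(X) ⊂ CSp(V, φ)`")] [cite: Gordon1997, §2 Lemma 2.7] -/
theorem exists_transpose_mul_J_mul_eq_smul_of_mem_mumfordTateGroup_prinPeriod (hg : 0 < g)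
    {A : GL (Fin g ⊕ Fin g) ℝ} (hA : A ∈ mumfordTateGroup (prinPeriod Z)) :
    ∃ t : ℝˣ, (A : Matrix (Fin g ⊕ Fin g) (Fin g ⊕ Fin g) ℝ)ᵀ * Matrix.J (Fin g) ℝ * A = (t : ℝ) • Matrix.J (Fin g) ℝ ∧
      extGL (Fin g ⊕ Fin g) ℝ (A, t) ∈ extMumfordTateGroup (prinPeriod Z) := by
  haveI : Nonempty (Fin g ⊕ Fin g) := ⟨Sum.inl ⟨0, hg⟩⟩
  have hη := isRiemannForm_prinForm Z
  obtain ⟨ν, hν⟩ := exists_transpose_mul_latticeGram_mul_eq_smul_of_mem_mumfordTateGroup hη.1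
    hη.exists_ratMatrix_latticeGram hA
  have hν0 : ν ≠ 0 :=
    multiplier_ne_zero ((Matrix.isUnit_iff_isUnit_det _).1 (Units.isUnit A)) hη.latticeGram_ne_zero hν
  have hmem : extGL (Fin g ⊕ Fin g) ℝ (A, Units.mk0 ν hν0) ∈ extMumfordTateGroup (prinPeriod Z) :=
    (hη.extGL_mem_extMumfordTateGroup_iff).2 ⟨hA, hν⟩
  exact ⟨Units.mk0 ν hν0, ((extGL_mem_extMumfordTateGroup_prinPeriod_iff Z hg).1 hmem).2, hmem⟩

end Multiplier

/-! ## §2 The product locus `𝔥_{g₁} × 𝔥_{g₂} → 𝔥_g`: `MT(X_{(Z₁ 0; 0 Z₂)}) = MT(X_{Z₁}) ×_{𝔾_m} MT(X_{Z₂})` iff the Hodge groups multiply -/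

section FibreProduct

variable (e : Fin g₁ ⊕ Fin g₂ ≃ Fin g) (Z₁ : siegelUpperHalfSpace g₁) (Z₂ : siegelUpperHalfSpace g₂)
  {ε : (Fin g₁ ⊕ Fin g₁) ⊕ (Fin g₂ ⊕ Fin g₂) ≃ Fin g ⊕ Fin g}

/-- **GORDON'S LEMMA 2.7 ON THE PRODUCT LOCUS (ALWAYS): every `N ∈ MT(X_{(Z₁ 0; 0 Z₂)})(ℝ)` is `reindex_ε (A 0; 0 B)` with
`(A, t) ∈ M̃T(X_{Z₁})(ℝ)` and `(B, t) ∈ M̃T(X_{Z₂})(ℝ)` for a COMMON multiplier `t ∈ ℝ^×`** — `MT(X_{(Z₁ 0; 0 Z₂)}) ⊆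
MT(X_{Z₁}) ×_{𝔾_m} MT(X_{Z₂})` (the multiplier of `N` on `E_{(Z₁ 0; 0 Z₂)} = E_{Z₁} ⊞ E_{Z₂}`; `g₁, g₂ ≥ 1`).
[cite: Gordon1997, §2 Lemma 2.7] [cite: Moonen1999MTNotes, (1.13) and (1.14)] [cite: Moonen2004MT, §4 Lemma 4.6 and §5 (5.2)] -/
theorem exists_extGL_mem_of_mem_mumfordTateGroup_prinPeriod_blockDiagPoint
    (h₁ : ∀ i, ε (Sum.inl (Sum.inl i)) = Sum.inl (e (Sum.inl i))) (h₂ : ∀ i, ε (Sum.inl (Sum.inr i)) = Sum.inr (e (Sum.inl i)))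
    (h₃ : ∀ j, ε (Sum.inr (Sum.inl j)) = Sum.inl (e (Sum.inr j))) (h₄ : ∀ j, ε (Sum.inr (Sum.inr j)) = Sum.inr (e (Sum.inr j)))
    (hg₁ : 0 < g₁) (hg₂ : 0 < g₂) {N : GL (Fin g ⊕ Fin g) ℝ} (hN : N ∈ mumfordTateGroup (prinPeriod (blockDiagPoint e Z₁ Z₂))) :
    ∃ (A : GL (Fin g₁ ⊕ Fin g₁) ℝ) (B : GL (Fin g₂ ⊕ Fin g₂) ℝ) (t : ℝˣ),
      extGL (Fin g₁ ⊕ Fin g₁) ℝ (A, t) ∈ extMumfordTateGroup (prinPeriod Z₁) ∧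
        extGL (Fin g₂ ⊕ Fin g₂) ℝ (B, t) ∈ extMumfordTateGroup (prinPeriod Z₂) ∧
          (N : Matrix (Fin g ⊕ Fin g) (Fin g ⊕ Fin g) ℝ) =
            Matrix.reindex ε ε (fromBlocks (A : Matrix _ _ ℝ) 0 0 (B : Matrix _ _ ℝ)) := by
  haveI : Nonempty (Fin g₁ ⊕ Fin g₁) := ⟨Sum.inl ⟨0, hg₁⟩⟩
  haveI : Nonempty (Fin g₂ ⊕ Fin g₂) := ⟨Sum.inl ⟨0, hg₂⟩⟩
  have hη₁ := isRiemannForm_prinForm Z₁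
  have hη₂ := isRiemannForm_prinForm Z₂
  obtain ⟨M, hM, hMN⟩ := (mem_mumfordTateGroup_prinPeriod_blockDiagPoint_iff e Z₁ Z₂ h₁ h₂ h₃ h₄).1 hN
  obtain ⟨A, hA, B, hB, rfl⟩ := exists_eq_blockDiagGL_of_mem_mumfordTateGroup_prod _ _ hM
  obtain ⟨ν, hνA, hνB⟩ := hη₁.exists_common_multiplier_of_blockDiagGL_mem_mumfordTateGroup_prod hη₂ hM
  have hν0 : ν ≠ 0 :=
    multiplier_ne_zero ((Matrix.isUnit_iff_isUnit_det _).1 (Units.isUnit A)) hη₁.latticeGram_ne_zero hνA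
  exact ⟨A, B, Units.mk0 ν hν0, (hη₁.extGL_mem_extMumfordTateGroup_iff).2 ⟨hA, hνA⟩,
    (hη₂.extGL_mem_extMumfordTateGroup_iff).2 ⟨hB, hνB⟩, by rw [← hMN, coe_blockDiagGL]⟩

/-- **… with the multipliers spelled out: `A ∈ MT(X_{Z₁})(ℝ)`, `B ∈ MT(X_{Z₂})(ℝ)` and `ᵗA J A = t J`, `ᵗB J B = t J` for ONE
`t ∈ ℝ^×`** — whence g30-#11's `det(A)^{2g₂} = t^{2 g₁ g₂} = det(B)^{2g₁}`. [cite: Gordon1997, §2 Lemma 2.7] [cite: Moonen2004MT, §4 Lemma 4.6 and §5 (5.2)]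
[cite: CarlsonMullerStachPeters2017, §15.2 Problem 15.2.3 (a)] -/
theorem exists_common_multiplier_of_mem_mumfordTateGroup_prinPeriod_blockDiagPoint
    (h₁ : ∀ i, ε (Sum.inl (Sum.inl i)) = Sum.inl (e (Sum.inl i))) (h₂ : ∀ i, ε (Sum.inl (Sum.inr i)) = Sum.inr (e (Sum.inl i)))
    (h₃ : ∀ j, ε (Sum.inr (Sum.inl j)) = Sum.inl (e (Sum.inr j))) (h₄ : ∀ j, ε (Sum.inr (Sum.inr j)) = Sum.inr (e (Sum.inr j)))
    (hg₁ : 0 < g₁) (hg₂ : 0 < g₂) {N : GL (Fin g ⊕ Fin g) ℝ} (hN : N ∈ mumfordTateGroup (prinPeriod (blockDiagPoint e Z₁ Z₂))) :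
    ∃ A ∈ mumfordTateGroup (prinPeriod Z₁), ∃ B ∈ mumfordTateGroup (prinPeriod Z₂), ∃ t : ℝˣ,
      (A : Matrix (Fin g₁ ⊕ Fin g₁) (Fin g₁ ⊕ Fin g₁) ℝ)ᵀ * Matrix.J (Fin g₁) ℝ * A = (t : ℝ) • Matrix.J (Fin g₁) ℝ ∧
        (B : Matrix (Fin g₂ ⊕ Fin g₂) (Fin g₂ ⊕ Fin g₂) ℝ)ᵀ * Matrix.J (Fin g₂) ℝ * B = (t : ℝ) • Matrix.J (Fin g₂) ℝ ∧
          (N : Matrix (Fin g ⊕ Fin g) (Fin g ⊕ Fin g) ℝ) =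
            Matrix.reindex ε ε (fromBlocks (A : Matrix _ _ ℝ) 0 0 (B : Matrix _ _ ℝ)) := by
  obtain ⟨A, B, t, hA, hB, hNAB⟩ :=
    exists_extGL_mem_of_mem_mumfordTateGroup_prinPeriod_blockDiagPoint e Z₁ Z₂ h₁ h₂ h₃ h₄ hg₁ hg₂ hN
  rw [extGL_mem_extMumfordTateGroup_prinPeriod_iff Z₁ hg₁] at hA
  rw [extGL_mem_extMumfordTateGroup_prinPeriod_iff Z₂ hg₂] at hB
  exact ⟨A, hA.1, B, hB.1, t, hA.2, hB.2, hNAB⟩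

/-- The complex-points hypothesis of the Kaehler layer's criterion from the real-points equality of the Hodge groups
(density of the real points, polarised tori). [cite: MoonenZarhin1999LowDim, §3 (3.1)] [cite: Springer1998, §13.3 Cor. 13.3.9 (ii)] -/
private theorem forall_blockDiagC_mem_hodgeGroupC_prod_of_hodgeGroup_prod_eq
    (hprod : hodgeGroup (prodPeriod (prinPeriod Z₁) (prinPeriod Z₂)) =
      ((hodgeGroup (prinPeriod Z₁)).prod (hodgeGroup (prinPeriod Z₂))).map
        (ComplexTorus.blockDiag (Fin g₁ ⊕ Fin g₁) (Fin g₂ ⊕ Fin g₂))) :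
    ∀ N₁ ∈ hodgeGroupC (prinPeriod Z₁), ∀ N₂ ∈ hodgeGroupC (prinPeriod Z₂),
      blockDiagC (Fin g₁ ⊕ Fin g₁) (Fin g₂ ⊕ Fin g₂) (N₁, N₂) ∈ hodgeGroupC (prodPeriod (prinPeriod Z₁) (prinPeriod Z₂)) := by
  intro N₁ hN₁ N₂ hN₂
  rw [(isRiemannForm_prinForm Z₁).hodgeGroupC_prod_eq_of_hodgeGroup_prod_eq (isRiemannForm_prinForm Z₂) hprod]
  exact blockDiagC_mem_blockDiagProd_iff.2 ⟨hN₁, hN₂⟩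

/-- **THE FIBRE PRODUCT, REAL POINTS.** When `Hg(X_{Z₁} × X_{Z₂})(ℝ) = Hg(X_{Z₁})(ℝ) × Hg(X_{Z₂})(ℝ)` (`g₁, g₂ ≥ 1`):
**`N ∈ MT(X_{(Z₁ 0; 0 Z₂)})(ℝ) ⟺ N = reindex_ε (A 0; 0 B)` with `(A, t) ∈ M̃T(X_{Z₁})(ℝ)`, `(B, t) ∈ M̃T(X_{Z₂})(ℝ)` for a common
`t ∈ ℝ^×`** — `MT(X_{(Z₁ 0; 0 Z₂)}) = MT(X_{Z₁}) ×_{𝔾_m} MT(X_{Z₂})` over the multiplier characters: in `MT(V₁) × MT(V₂)` «the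
central factor `𝔾_m` is counted twice», in the fibre product once, and no other defect is left when the Hodge groups multiply.
[cite: Moonen1999MTNotes, (1.11), (1.13) and (1.14)] [cite: Moonen2004MT, §4 Lemma 4.6, (4.7) and §5 (5.2)] [cite: Gordon1997, §2 Lemma 2.7] -/
theorem mem_mumfordTateGroup_prinPeriod_blockDiagPoint_iff_exists_extGL_of_hodgeGroup_prod_eq
    (h₁ : ∀ i, ε (Sum.inl (Sum.inl i)) = Sum.inl (e (Sum.inl i))) (h₂ : ∀ i, ε (Sum.inl (Sum.inr i)) = Sum.inr (e (Sum.inl i)))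
    (h₃ : ∀ j, ε (Sum.inr (Sum.inl j)) = Sum.inl (e (Sum.inr j))) (h₄ : ∀ j, ε (Sum.inr (Sum.inr j)) = Sum.inr (e (Sum.inr j)))
    (hg₁ : 0 < g₁) (hg₂ : 0 < g₂)
    (hprod : hodgeGroup (prodPeriod (prinPeriod Z₁) (prinPeriod Z₂)) =
      ((hodgeGroup (prinPeriod Z₁)).prod (hodgeGroup (prinPeriod Z₂))).map
        (ComplexTorus.blockDiag (Fin g₁ ⊕ Fin g₁) (Fin g₂ ⊕ Fin g₂)))
    {N : GL (Fin g ⊕ Fin g) ℝ} :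
    N ∈ mumfordTateGroup (prinPeriod (blockDiagPoint e Z₁ Z₂)) ↔
      ∃ (A : GL (Fin g₁ ⊕ Fin g₁) ℝ) (B : GL (Fin g₂ ⊕ Fin g₂) ℝ) (t : ℝˣ),
        extGL (Fin g₁ ⊕ Fin g₁) ℝ (A, t) ∈ extMumfordTateGroup (prinPeriod Z₁) ∧
          extGL (Fin g₂ ⊕ Fin g₂) ℝ (B, t) ∈ extMumfordTateGroup (prinPeriod Z₂) ∧
            (N : Matrix (Fin g ⊕ Fin g) (Fin g ⊕ Fin g) ℝ) =
              Matrix.reindex ε ε (fromBlocks (A : Matrix _ _ ℝ) 0 0 (B : Matrix _ _ ℝ)) := by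
  refine ⟨exists_extGL_mem_of_mem_mumfordTateGroup_prinPeriod_blockDiagPoint e Z₁ Z₂ h₁ h₂ h₃ h₄ hg₁ hg₂, ?_⟩
  haveI : Nonempty (Fin g₁ ⊕ Fin g₁) := ⟨Sum.inl ⟨0, hg₁⟩⟩
  haveI : Nonempty (Fin g₂ ⊕ Fin g₂) := ⟨Sum.inl ⟨0, hg₂⟩⟩
  have hη₁ := isRiemannForm_prinForm Z₁
  have hη₂ := isRiemannForm_prinForm Z₂
  rintro ⟨A, B, t, hA, hB, hNAB⟩
  refine (mem_mumfordTateGroup_prinPeriod_blockDiagPoint_iff e Z₁ Z₂ h₁ h₂ h₃ h₄).2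
    ⟨blockDiagGL (Fin g₁ ⊕ Fin g₁) (Fin g₂ ⊕ Fin g₂) ℝ (A, B), ?_, by rw [hNAB, coe_blockDiagGL]⟩
  exact (blockDiagGL_mem_mumfordTateGroup_prod_iff_of_forall_blockDiagC_mem _ _ hη₁.1 hη₁.exists_ratMatrix_latticeGram
    hη₁.latticeGram_ne_zero hη₂.1 hη₂.exists_ratMatrix_latticeGram hη₂.latticeGram_ne_zero
    (forall_blockDiagC_mem_hodgeGroupC_prod_of_hodgeGroup_prod_eq Z₁ Z₂ hprod)).2 ⟨t, hA, hB⟩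

/-- **THE FIBRE PRODUCT WITH THE MULTIPLIERS SPELLED OUT.** When `Hg(X_{Z₁} × X_{Z₂})(ℝ) = Hg(X_{Z₁})(ℝ) × Hg(X_{Z₂})(ℝ)`
(`g₁, g₂ ≥ 1`): **`N ∈ MT(X_{(Z₁ 0; 0 Z₂)})(ℝ) ⟺ N = reindex_ε (A 0; 0 B)` with `A ∈ MT(X_{Z₁})(ℝ)`, `B ∈ MT(X_{Z₂})(ℝ)` and
`ᵗA J A = t J`, `ᵗB J B = t J` for ONE `t ∈ ℝ`** (the equality case of g30-#11's
`exists_eq_reindex_fromBlocks_of_mem_mumfordTateGroup_prinPeriod_blockDiagPoint`). [cite: Moonen1999MTNotes, (1.11), (1.13), (1.14)]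
[cite: Moonen2004MT, §4 Lemma 4.6 and §5 (5.2)] [cite: Gordon1997, §2 Lemma 2.7] -/
theorem mem_mumfordTateGroup_prinPeriod_blockDiagPoint_iff_of_hodgeGroup_prod_eq
    (h₁ : ∀ i, ε (Sum.inl (Sum.inl i)) = Sum.inl (e (Sum.inl i))) (h₂ : ∀ i, ε (Sum.inl (Sum.inr i)) = Sum.inr (e (Sum.inl i)))
    (h₃ : ∀ j, ε (Sum.inr (Sum.inl j)) = Sum.inl (e (Sum.inr j))) (h₄ : ∀ j, ε (Sum.inr (Sum.inr j)) = Sum.inr (e (Sum.inr j)))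
    (hg₁ : 0 < g₁) (hg₂ : 0 < g₂)
    (hprod : hodgeGroup (prodPeriod (prinPeriod Z₁) (prinPeriod Z₂)) =
      ((hodgeGroup (prinPeriod Z₁)).prod (hodgeGroup (prinPeriod Z₂))).map
        (ComplexTorus.blockDiag (Fin g₁ ⊕ Fin g₁) (Fin g₂ ⊕ Fin g₂)))
    {N : GL (Fin g ⊕ Fin g) ℝ} :
    N ∈ mumfordTateGroup (prinPeriod (blockDiagPoint e Z₁ Z₂)) ↔
      ∃ A ∈ mumfordTateGroup (prinPeriod Z₁), ∃ B ∈ mumfordTateGroup (prinPeriod Z₂), ∃ t : ℝ,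
        (A : Matrix (Fin g₁ ⊕ Fin g₁) (Fin g₁ ⊕ Fin g₁) ℝ)ᵀ * Matrix.J (Fin g₁) ℝ * A = t • Matrix.J (Fin g₁) ℝ ∧
          (B : Matrix (Fin g₂ ⊕ Fin g₂) (Fin g₂ ⊕ Fin g₂) ℝ)ᵀ * Matrix.J (Fin g₂) ℝ * B = t • Matrix.J (Fin g₂) ℝ ∧
            (N : Matrix (Fin g ⊕ Fin g) (Fin g ⊕ Fin g) ℝ) =
              Matrix.reindex ε ε (fromBlocks (A : Matrix _ _ ℝ) 0 0 (B : Matrix _ _ ℝ)) := by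
  constructor
  · intro hN
    obtain ⟨A, hA, B, hB, t, htA, htB, hNAB⟩ :=
      exists_common_multiplier_of_mem_mumfordTateGroup_prinPeriod_blockDiagPoint e Z₁ Z₂ h₁ h₂ h₃ h₄ hg₁ hg₂ hN
    exact ⟨A, hA, B, hB, t, htA, htB, hNAB⟩
  · rintro ⟨A, hA, B, hB, t, htA, htB, hNAB⟩
    haveI : Nonempty (Fin g₁ ⊕ Fin g₁) := ⟨Sum.inl ⟨0, hg₁⟩⟩
    have hJ0 : latticeGram (prinPeriod Z₁) (prinForm Z₁) ≠ 0 := (isRiemannForm_prinForm Z₁).latticeGram_ne_zero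
    have ht0 : t ≠ 0 := by
      refine multiplier_ne_zero ((Matrix.isUnit_iff_isUnit_det _).1 (Units.isUnit A)) hJ0 ?_
      rw [latticeGram_prinForm, transpose_mul_neg_mul_eq_smul_neg_iff]
      exact htA
    refine (mem_mumfordTateGroup_prinPeriod_blockDiagPoint_iff_exists_extGL_of_hodgeGroup_prod_eq e Z₁ Z₂ h₁ h₂ h₃ h₄
      hg₁ hg₂ hprod).2 ⟨A, B, Units.mk0 t ht0, ?_, ?_, hNAB⟩
    · exact (extGL_mem_extMumfordTateGroup_prinPeriod_iff Z₁ hg₁).2 ⟨hA, by rw [Units.val_mk0]; exact htA⟩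
    · exact (extGL_mem_extMumfordTateGroup_prinPeriod_iff Z₂ hg₂).2 ⟨hB, by rw [Units.val_mk0]; exact htB⟩

/-- **THE FIBRE PRODUCT, COMPLEX POINTS.** When `Hg(X_{Z₁} × X_{Z₂})(ℝ) = Hg(X_{Z₁})(ℝ) × Hg(X_{Z₂})(ℝ)` (`g₁, g₂ ≥ 1`):
**`N ∈ MT(X_{(Z₁ 0; 0 Z₂)})(ℂ) ⟺ N = reindex_ε (A 0; 0 B)` with `A ∈ MT(X_{Z₁})(ℂ)`, `B ∈ MT(X_{Z₂})(ℂ)` and `ᵗA J A = c J`,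
`ᵗB J B = c J` for ONE `c ∈ ℂ`.** [cite: Moonen1999MTNotes, (1.11), (1.13), (1.14)] [cite: Moonen2004MT, §4 Lemma 4.6, (4.7) and §5 (5.2)] -/
theorem mem_mumfordTateGroupC_prinPeriod_blockDiagPoint_iff_of_hodgeGroup_prod_eq
    (h₁ : ∀ i, ε (Sum.inl (Sum.inl i)) = Sum.inl (e (Sum.inl i))) (h₂ : ∀ i, ε (Sum.inl (Sum.inr i)) = Sum.inr (e (Sum.inl i)))
    (h₃ : ∀ j, ε (Sum.inr (Sum.inl j)) = Sum.inl (e (Sum.inr j))) (h₄ : ∀ j, ε (Sum.inr (Sum.inr j)) = Sum.inr (e (Sum.inr j)))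
    (hg₁ : 0 < g₁) (hg₂ : 0 < g₂)
    (hprod : hodgeGroup (prodPeriod (prinPeriod Z₁) (prinPeriod Z₂)) =
      ((hodgeGroup (prinPeriod Z₁)).prod (hodgeGroup (prinPeriod Z₂))).map
        (ComplexTorus.blockDiag (Fin g₁ ⊕ Fin g₁) (Fin g₂ ⊕ Fin g₂)))
    {N : GL (Fin g ⊕ Fin g) ℂ} :
    N ∈ mumfordTateGroupC (prinPeriod (blockDiagPoint e Z₁ Z₂)) ↔
      ∃ A ∈ mumfordTateGroupC (prinPeriod Z₁), ∃ B ∈ mumfordTateGroupC (prinPeriod Z₂), ∃ c : ℂ,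
        (A : Matrix (Fin g₁ ⊕ Fin g₁) (Fin g₁ ⊕ Fin g₁) ℂ)ᵀ * Matrix.J (Fin g₁) ℂ * A = c • Matrix.J (Fin g₁) ℂ ∧
          (B : Matrix (Fin g₂ ⊕ Fin g₂) (Fin g₂ ⊕ Fin g₂) ℂ)ᵀ * Matrix.J (Fin g₂) ℂ * B = c • Matrix.J (Fin g₂) ℂ ∧
            (N : Matrix (Fin g ⊕ Fin g) (Fin g ⊕ Fin g) ℂ) =
              Matrix.reindex ε ε (fromBlocks (A : Matrix _ _ ℂ) 0 0 (B : Matrix _ _ ℂ)) := by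
  haveI : Nonempty (Fin g₁ ⊕ Fin g₁) := ⟨Sum.inl ⟨0, hg₁⟩⟩
  haveI : Nonempty (Fin g₂ ⊕ Fin g₂) := ⟨Sum.inl ⟨0, hg₂⟩⟩
  have hη₁ := isRiemannForm_prinForm Z₁
  have hη₂ := isRiemannForm_prinForm Z₂
  have hcrit : ∀ {A : GL (Fin g₁ ⊕ Fin g₁) ℂ} {B : GL (Fin g₂ ⊕ Fin g₂) ℂ},
      blockDiagGL (Fin g₁ ⊕ Fin g₁) (Fin g₂ ⊕ Fin g₂) ℂ (A, B) ∈ mumfordTateGroupC (prodPeriod (prinPeriod Z₁) (prinPeriod Z₂)) ↔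
        ∃ c : ℂˣ, extGL (Fin g₁ ⊕ Fin g₁) ℂ (A, c) ∈ extMumfordTateGroupC (prinPeriod Z₁) ∧
          extGL (Fin g₂ ⊕ Fin g₂) ℂ (B, c) ∈ extMumfordTateGroupC (prinPeriod Z₂) := fun {A B} ↦
    blockDiagGL_mem_mumfordTateGroupC_prod_iff_of_forall_blockDiagC_mem _ _ hη₁.1 hη₁.exists_ratMatrix_latticeGram
      hη₁.latticeGram_ne_zero hη₂.1 hη₂.exists_ratMatrix_latticeGram hη₂.latticeGram_ne_zero
      (forall_blockDiagC_mem_hodgeGroupC_prod_of_hodgeGroup_prod_eq Z₁ Z₂ hprod)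
  rw [mem_mumfordTateGroupC_prinPeriod_blockDiagPoint_iff e Z₁ Z₂ h₁ h₂ h₃ h₄]
  constructor
  · rintro ⟨M, hM, hMN⟩
    obtain ⟨A, hA, B, hB, rfl⟩ := exists_eq_blockDiagGL_of_mem_mumfordTateGroupC_prod _ _ hM
    obtain ⟨c, hcA, hcB⟩ := hcrit.1 hM
    rw [extGL_mem_extMumfordTateGroupC_prinPeriod_iff Z₁ hg₁] at hcA
    rw [extGL_mem_extMumfordTateGroupC_prinPeriod_iff Z₂ hg₂] at hcB
    exact ⟨A, hA, B, hB, c, hcA.2, hcB.2, by rw [← hMN, coe_blockDiagGL]⟩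
  · rintro ⟨A, hA, B, hB, c, hcA, hcB, hNAB⟩
    have hJ0 : (latticeGram (prinPeriod Z₁) (prinForm Z₁)).map Complex.ofRealHom ≠ 0 := by
      rw [latticeGram_prinForm, Matrix.map_neg _ (map_neg Complex.ofRealHom), Matrix.map_J, neg_ne_zero]
      intro h
      have h10 := congrFun (congrFun h (Sum.inr ⟨0, hg₁⟩)) (Sum.inl ⟨0, hg₁⟩)
      simp [Matrix.J] at h10
    have hc0 : c ≠ 0 := by
      refine multiplier_ne_zero ((Matrix.isUnit_iff_isUnit_det _).1 (Units.isUnit A)) hJ0 ?_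
      rw [latticeGram_prinForm, Matrix.map_neg _ (map_neg Complex.ofRealHom), Matrix.map_J,
        transpose_mul_neg_mul_eq_smul_neg_iff]
      exact hcA
    refine ⟨blockDiagGL (Fin g₁ ⊕ Fin g₁) (Fin g₂ ⊕ Fin g₂) ℂ (A, B), hcrit.2 ⟨Units.mk0 c hc0, ?_, ?_⟩,
      by rw [hNAB, coe_blockDiagGL]⟩
    · exact (extGL_mem_extMumfordTateGroupC_prinPeriod_iff Z₁ hg₁).2 ⟨hA, by rw [Units.val_mk0]; exact hcA⟩
    · exact (extGL_mem_extMumfordTateGroupC_prinPeriod_iff Z₂ hg₂).2 ⟨hB, by rw [Units.val_mk0]; exact hcB⟩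

/-- **EQUALITY IN MOONEN'S (1.13) FOR `M̃T`: `M̃T(X_{Z₁} × X_{Z₂})(ℝ) = M̃T(X_{Z₁})(ℝ) ×_{ℝ^×} M̃T(X_{Z₂})(ℝ)` when
`Hg(X_{Z₁} × X_{Z₂})(ℝ) = Hg(X_{Z₁})(ℝ) × Hg(X_{Z₂})(ℝ)`** (`g₁, g₂ ≥ 1`; the Kaehler layer's `extMumfordTateGroup_prod_le` is an
equality). [cite: Moonen1999MTNotes, (1.13) and (1.14)] [cite: Moonen2004MT, §4 Lemma 4.6, (4.7) and §5 (5.2)] -/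
theorem extMumfordTateGroup_prod_prinPeriod_eq_of_hodgeGroup_prod_eq (hg₁ : 0 < g₁) (hg₂ : 0 < g₂)
    (hprod : hodgeGroup (prodPeriod (prinPeriod Z₁) (prinPeriod Z₂)) =
      ((hodgeGroup (prinPeriod Z₁)).prod (hodgeGroup (prinPeriod Z₂))).map
        (ComplexTorus.blockDiag (Fin g₁ ⊕ Fin g₁) (Fin g₂ ⊕ Fin g₂))) :
    extMumfordTateGroup (prodPeriod (prinPeriod Z₁) (prinPeriod Z₂)) =
      (extFiberProd (prinPeriod Z₁) (prinPeriod Z₂)).map (extProdGL (Fin g₁ ⊕ Fin g₁) (Fin g₂ ⊕ Fin g₂) ℝ) := by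
  haveI : Nonempty (Fin g₁ ⊕ Fin g₁) := ⟨Sum.inl ⟨0, hg₁⟩⟩
  haveI : Nonempty (Fin g₂ ⊕ Fin g₂) := ⟨Sum.inl ⟨0, hg₂⟩⟩
  have hC := (isRiemannForm_prinForm Z₁).hodgeGroupC_prod_eq_of_hodgeGroup_prod_eq (isRiemannForm_prinForm Z₂) hprod
  rw [blockDiagProd] at hC
  exact IsRiemannForm.extMumfordTateGroup_prod_eq_of_hodgeGroupC_prod_eq (prinPeriod Z₁) (prinPeriod Z₂)
    (isRiemannForm_prinForm Z₁) (isRiemannForm_prinForm Z₂) hC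

/-- **ON COMPLEX POINTS THE CRITERION IS SHARP: `M̃T(X_{Z₁} × X_{Z₂})(ℂ) = M̃T(X_{Z₁})(ℂ) ×_{ℂ^×} M̃T(X_{Z₂})(ℂ)` IFF
`Hg(X_{Z₁} × X_{Z₂})(ℝ) = Hg(X_{Z₁})(ℝ) × Hg(X_{Z₂})(ℝ)`** (`g₁, g₂ ≥ 1`): the Kaehler layer's criterion
(`M̃T` equality iff `Hg(ℂ)` equality) and, for the principally polarised `X_{Zᵢ}`, `Hg(ℂ)` equality iff `Hg(ℝ)` equality
(density of the real points). [cite: Moonen1999MTNotes, (1.13) and (1.14)] [cite: Moonen2004MT, §5 (5.2), (5.8)]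
[cite: MoonenZarhin1999LowDim, §3 (3.1)] -/
theorem extMumfordTateGroupC_prod_prinPeriod_eq_iff_hodgeGroup_prod_eq (hg₁ : 0 < g₁) (hg₂ : 0 < g₂) :
    extMumfordTateGroupC (prodPeriod (prinPeriod Z₁) (prinPeriod Z₂)) =
        (extFiberProdC (prinPeriod Z₁) (prinPeriod Z₂)).map (extProdGL (Fin g₁ ⊕ Fin g₁) (Fin g₂ ⊕ Fin g₂) ℂ) ↔
      hodgeGroup (prodPeriod (prinPeriod Z₁) (prinPeriod Z₂)) =
        ((hodgeGroup (prinPeriod Z₁)).prod (hodgeGroup (prinPeriod Z₂))).map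
          (ComplexTorus.blockDiag (Fin g₁ ⊕ Fin g₁) (Fin g₂ ⊕ Fin g₂)) := by
  haveI : Nonempty (Fin g₁ ⊕ Fin g₁) := ⟨Sum.inl ⟨0, hg₁⟩⟩
  haveI : Nonempty (Fin g₂ ⊕ Fin g₂) := ⟨Sum.inl ⟨0, hg₂⟩⟩
  rw [IsRiemannForm.extMumfordTateGroupC_prod_eq_iff_hodgeGroupC_prod_eq (prinPeriod Z₁) (prinPeriod Z₂)
      (isRiemannForm_prinForm Z₁) (isRiemannForm_prinForm Z₂),
    ← (isRiemannForm_prinForm Z₁).hodgeGroupC_prod_eq_iff_hodgeGroup_prod_eq (isRiemannForm_prinForm Z₂), blockDiagProd]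

end FibreProduct

/-! ## §3 `𝔥₁ × 𝔥_n → 𝔥_{1+n}`, a NON-CM elliptic block and a CM-type block: `MT(X_{(τ 0; 0 Z)}) = GL₂ ×_{det = ν} MT(X_Z)` -/

section EllipticBlock

variable (Z₁ : siegelUpperHalfSpace 1) (Z₂ : siegelUpperHalfSpace n)

/-- **`Hg(X_τ × X_Z)(ℂ) = Hg(X_τ)(ℂ) × Hg(X_Z)(ℂ)` ON COMPLEX POINTS** for `τ ∈ 𝔥₁` not a CM point and `Hg(X_Z)(ℂ)` commutative
(the complex points of g30-#9's `hodgeGroup_prod_prinPeriod_one_eq_of_not_isCMPoint`, by the density of the real points).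
[cite: MoonenZarhin1999LowDim, §3 Theorem (2) (p0006 L70–L76) and (3.1)] [cite: Imai1976HodgeGroups, §2 Proposition (pp. 368, 370)] -/
theorem hodgeGroupC_prod_prinPeriod_one_eq_of_not_isCMPoint (h₁ : ¬ IsCMPoint Z₁)
    (hc : ∀ M ∈ hodgeGroupC (prinPeriod Z₂), ∀ N ∈ hodgeGroupC (prinPeriod Z₂), M * N = N * M) :
    hodgeGroupC (prodPeriod (prinPeriod Z₁) (prinPeriod Z₂)) =
      blockDiagProd (hodgeGroupC (prinPeriod Z₁)) (hodgeGroupC (prinPeriod Z₂)) :=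
  (isRiemannForm_prinForm Z₁).hodgeGroupC_prod_eq_of_hodgeGroup_prod_eq (isRiemannForm_prinForm Z₂)
    (hodgeGroup_prod_prinPeriod_one_eq_of_not_isCMPoint Z₁ Z₂ h₁ hc)

/-- **`M̃T(X_τ × X_Z)(ℝ) = M̃T(X_τ)(ℝ) ×_{ℝ^×} M̃T(X_Z)(ℝ)`** for `τ ∈ 𝔥₁` not a CM point and `Z ∈ 𝔥_n` (`n ≥ 1`) with `Hg(X_Z)(ℂ)`
commutative — equality in Moonen's (1.13) for `M̃T`. [cite: Moonen1999MTNotes, (1.13) and (1.14)] [cite: MoonenZarhin1999LowDim, §3 Theorem (2) (p0006 L70–L76)]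
[cite: Moonen2004MT, §5 (5.2) and (5.6) Exercise] -/
theorem extMumfordTateGroup_prod_prinPeriod_one_eq_of_not_isCMPoint (hn : 0 < n) (h₁ : ¬ IsCMPoint Z₁)
    (hc : ∀ M ∈ hodgeGroupC (prinPeriod Z₂), ∀ N ∈ hodgeGroupC (prinPeriod Z₂), M * N = N * M) :
    extMumfordTateGroup (prodPeriod (prinPeriod Z₁) (prinPeriod Z₂)) =
      (extFiberProd (prinPeriod Z₁) (prinPeriod Z₂)).map (extProdGL (Fin 1 ⊕ Fin 1) (Fin n ⊕ Fin n) ℝ) :=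
  extMumfordTateGroup_prod_prinPeriod_eq_of_hodgeGroup_prod_eq Z₁ Z₂ one_pos hn
    (hodgeGroup_prod_prinPeriod_one_eq_of_not_isCMPoint Z₁ Z₂ h₁ hc)

variable (e : Fin 1 ⊕ Fin n ≃ Fin g) {ε : (Fin 1 ⊕ Fin 1) ⊕ (Fin n ⊕ Fin n) ≃ Fin g ⊕ Fin g}

/-- **`MT(X_{(τ 0; 0 Z)})(ℝ) = GL₂(ℝ) ×_{det = ν} MT(X_Z)(ℝ)` FOR `τ ∈ 𝔥₁` NOT A CM POINT AND `Z ∈ 𝔥_n` (`n ≥ 1`) WITH `Hg(X_Z)(ℂ)`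
COMMUTATIVE**: `N ∈ MT(X_{(τ 0; 0 Z)})(ℝ)` iff `N = reindex_ε (A 0; 0 B)` with `A ∈ GL(ℝ^{λ¹, μ¹})` ARBITRARY (`MT(X_τ) = GL₂`,
«if `C` has no complex multiplication … `MT(H¹(C)) = GL(2)`»), `B ∈ MT(X_Z)(ℝ)`, and `ᵗB J B = det(A) · J` (the multiplier of
`B` is the determinant of `A`: `GSp₂ = GL₂`, `ν = det`). [cite: MoonenZarhin1999LowDim, §3 Theorem (2) (p0006 L70–L76)]
[cite: CarlsonMullerStachPeters2017, §15.2 Examples 15.2.4 (ii) and Problem 15.2.3 (a)] [cite: Moonen1999MTNotes, (1.11), (1.13)]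
[cite: Moonen2004MT, §5 (5.2) and (5.6) Exercise] -/
theorem mem_mumfordTateGroup_prinPeriod_blockDiagPoint_iff_of_not_isCMPoint
    (h₁ : ∀ i, ε (Sum.inl (Sum.inl i)) = Sum.inl (e (Sum.inl i))) (h₂ : ∀ i, ε (Sum.inl (Sum.inr i)) = Sum.inr (e (Sum.inl i)))
    (h₃ : ∀ j, ε (Sum.inr (Sum.inl j)) = Sum.inl (e (Sum.inr j))) (h₄ : ∀ j, ε (Sum.inr (Sum.inr j)) = Sum.inr (e (Sum.inr j)))
    (hn : 0 < n) (hτ : ¬ IsCMPoint Z₁)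
    (hc : ∀ M ∈ hodgeGroupC (prinPeriod Z₂), ∀ N ∈ hodgeGroupC (prinPeriod Z₂), M * N = N * M)
    {N : GL (Fin g ⊕ Fin g) ℝ} :
    N ∈ mumfordTateGroup (prinPeriod (blockDiagPoint e Z₁ Z₂)) ↔
      ∃ A : GL (Fin 1 ⊕ Fin 1) ℝ, ∃ B ∈ mumfordTateGroup (prinPeriod Z₂),
        (B : Matrix (Fin n ⊕ Fin n) (Fin n ⊕ Fin n) ℝ)ᵀ * Matrix.J (Fin n) ℝ * B =
            (A : Matrix (Fin 1 ⊕ Fin 1) (Fin 1 ⊕ Fin 1) ℝ).det • Matrix.J (Fin n) ℝ ∧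
          (N : Matrix (Fin g ⊕ Fin g) (Fin g ⊕ Fin g) ℝ) =
            Matrix.reindex ε ε (fromBlocks (A : Matrix _ _ ℝ) 0 0 (B : Matrix _ _ ℝ)) := by
  rw [mem_mumfordTateGroup_prinPeriod_blockDiagPoint_iff_of_hodgeGroup_prod_eq e Z₁ Z₂ h₁ h₂ h₃ h₄ one_pos hn
    (hodgeGroup_prod_prinPeriod_one_eq_of_not_isCMPoint Z₁ Z₂ hτ hc),
    mumfordTateGroup_prinPeriod_one_eq_top_of_not_isCMPoint hτ]
  constructor
  · rintro ⟨A, -, B, hB, t, htA, htB, hNAB⟩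
    refine ⟨A, B, hB, ?_, hNAB⟩
    rw [transpose_mul_J_mul_fin_one] at htA
    have ht : (A : Matrix (Fin 1 ⊕ Fin 1) (Fin 1 ⊕ Fin 1) ℝ).det = t := by
      have h10 := congrFun (congrFun htA (Sum.inr 0)) (Sum.inl 0)
      simpa [Matrix.J] using h10
    rw [htB, ht]
  · rintro ⟨A, B, hB, hB', hNAB⟩
    exact ⟨A, Subgroup.mem_top A, B, hB, (A : Matrix (Fin 1 ⊕ Fin 1) (Fin 1 ⊕ Fin 1) ℝ).det,
      transpose_mul_J_mul_fin_one _, hB', hNAB⟩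

/-- The same with the CM-type hypothesis phrased «`MT(X_Z)(ℂ)` is a torus» (skel-A3: on the Siegel family the torus locus is
the locus where `Hg(X_Z)(ℂ)` is commutative). [cite: MoonenZarhin1999LowDim, §3 Theorem (2) (p0006 L70–L76)] [cite: Gordon1997, §2 Prop. 2.12] -/
theorem mem_mumfordTateGroup_prinPeriod_blockDiagPoint_iff_of_not_isCMPoint_of_isTorusSubgroup
    (h₁ : ∀ i, ε (Sum.inl (Sum.inl i)) = Sum.inl (e (Sum.inl i))) (h₂ : ∀ i, ε (Sum.inl (Sum.inr i)) = Sum.inr (e (Sum.inl i)))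
    (h₃ : ∀ j, ε (Sum.inr (Sum.inl j)) = Sum.inl (e (Sum.inr j))) (h₄ : ∀ j, ε (Sum.inr (Sum.inr j)) = Sum.inr (e (Sum.inr j)))
    (hn : 0 < n) (hτ : ¬ IsCMPoint Z₁) (hT : IsTorusSubgroup (mumfordTateGroupC (prinPeriod Z₂)))
    {N : GL (Fin g ⊕ Fin g) ℝ} :
    N ∈ mumfordTateGroup (prinPeriod (blockDiagPoint e Z₁ Z₂)) ↔
      ∃ A : GL (Fin 1 ⊕ Fin 1) ℝ, ∃ B ∈ mumfordTateGroup (prinPeriod Z₂),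
        (B : Matrix (Fin n ⊕ Fin n) (Fin n ⊕ Fin n) ℝ)ᵀ * Matrix.J (Fin n) ℝ * B =
            (A : Matrix (Fin 1 ⊕ Fin 1) (Fin 1 ⊕ Fin 1) ℝ).det • Matrix.J (Fin n) ℝ ∧
          (N : Matrix (Fin g ⊕ Fin g) (Fin g ⊕ Fin g) ℝ) =
            Matrix.reindex ε ε (fromBlocks (A : Matrix _ _ ℝ) 0 0 (B : Matrix _ _ ℝ)) :=
  mem_mumfordTateGroup_prinPeriod_blockDiagPoint_iff_of_not_isCMPoint Z₁ Z₂ e h₁ h₂ h₃ h₄ hn hτ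
    ((Set.ext_iff.1 (setOf_isTorusSubgroup_mumfordTateGroupC_eq_setOf_hodgeGroupC_comm n) Z₂).1 hT)

/-- **EVERY BLOCK SUM `reindex_ε (A 0; 0 B)` WITH `A ∈ GL(ℝ^{λ¹, μ¹})`, `B ∈ MT(X_Z)(ℝ)` AND `ᵗB J B = det(A) J` LIES IN
`MT(X_{(τ 0; 0 Z)})(ℝ)`** (`τ` non-CM, `Hg(X_Z)(ℂ)` commutative, `n ≥ 1`) — g30-#11's inclusion into the determinant fibre
product is attained on the multiplier fibre product. [cite: MoonenZarhin1999LowDim, §3 Theorem (2) (p0006 L70–L76)]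
[cite: Moonen2004MT, §5 (5.2) and (5.6) Exercise] -/
theorem reindex_fromBlocks_mem_mumfordTateGroup_prinPeriod_blockDiagPoint_of_not_isCMPoint
    (h₁ : ∀ i, ε (Sum.inl (Sum.inl i)) = Sum.inl (e (Sum.inl i))) (h₂ : ∀ i, ε (Sum.inl (Sum.inr i)) = Sum.inr (e (Sum.inl i)))
    (h₃ : ∀ j, ε (Sum.inr (Sum.inl j)) = Sum.inl (e (Sum.inr j))) (h₄ : ∀ j, ε (Sum.inr (Sum.inr j)) = Sum.inr (e (Sum.inr j)))
    (hn : 0 < n) (hτ : ¬ IsCMPoint Z₁)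
    (hc : ∀ M ∈ hodgeGroupC (prinPeriod Z₂), ∀ N ∈ hodgeGroupC (prinPeriod Z₂), M * N = N * M)
    (A : GL (Fin 1 ⊕ Fin 1) ℝ) {B : GL (Fin n ⊕ Fin n) ℝ} (hB : B ∈ mumfordTateGroup (prinPeriod Z₂))
    (hB' : (B : Matrix (Fin n ⊕ Fin n) (Fin n ⊕ Fin n) ℝ)ᵀ * Matrix.J (Fin n) ℝ * B =
      (A : Matrix (Fin 1 ⊕ Fin 1) (Fin 1 ⊕ Fin 1) ℝ).det • Matrix.J (Fin n) ℝ)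
    {N : GL (Fin g ⊕ Fin g) ℝ}
    (hN : (N : Matrix (Fin g ⊕ Fin g) (Fin g ⊕ Fin g) ℝ) = Matrix.reindex ε ε (fromBlocks (A : Matrix _ _ ℝ) 0 0 (B : Matrix _ _ ℝ))) :
    N ∈ mumfordTateGroup (prinPeriod (blockDiagPoint e Z₁ Z₂)) :=
  (mem_mumfordTateGroup_prinPeriod_blockDiagPoint_iff_of_not_isCMPoint Z₁ Z₂ e h₁ h₂ h₃ h₄ hn hτ hc).2 ⟨A, B, hB, hB', hN⟩

/-- **`MT(X_τ)(ℝ)`-BLOCKS ARE UNCONSTRAINED, `MT(X_Z)(ℝ)`-BLOCKS OF POSITIVE MULTIPLIER ALWAYS OCCUR**: for `B ∈ MT(X_Z)(ℝ)` with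
`ᵗB J B = t J`, `t > 0`, the block sum `reindex_ε (√t · 1 0; 0 B)` lies in `MT(X_{(τ 0; 0 Z)})(ℝ)` («the projections are
surjective», here realised by an explicit section over the positive multipliers). [cite: Moonen2004MT, §4 Lemma 4.6 / Remark ("the projections are surjective")]
[cite: MoonenZarhin1999LowDim, §3 Theorem (2) (p0006 L70–L76)] -/
theorem reindex_fromBlocks_sqrt_smul_one_mem_mumfordTateGroup_prinPeriod_blockDiagPoint_of_not_isCMPoint
    (h₁ : ∀ i, ε (Sum.inl (Sum.inl i)) = Sum.inl (e (Sum.inl i))) (h₂ : ∀ i, ε (Sum.inl (Sum.inr i)) = Sum.inr (e (Sum.inl i)))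
    (h₃ : ∀ j, ε (Sum.inr (Sum.inl j)) = Sum.inl (e (Sum.inr j))) (h₄ : ∀ j, ε (Sum.inr (Sum.inr j)) = Sum.inr (e (Sum.inr j)))
    (hn : 0 < n) (hτ : ¬ IsCMPoint Z₁)
    (hc : ∀ M ∈ hodgeGroupC (prinPeriod Z₂), ∀ N ∈ hodgeGroupC (prinPeriod Z₂), M * N = N * M)
    {B : GL (Fin n ⊕ Fin n) ℝ} (hB : B ∈ mumfordTateGroup (prinPeriod Z₂)) {t : ℝ} (ht : 0 < t)
    (hB' : (B : Matrix (Fin n ⊕ Fin n) (Fin n ⊕ Fin n) ℝ)ᵀ * Matrix.J (Fin n) ℝ * B = t • Matrix.J (Fin n) ℝ)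
    {N : GL (Fin g ⊕ Fin g) ℝ}
    (hN : (N : Matrix (Fin g ⊕ Fin g) (Fin g ⊕ Fin g) ℝ) =
      Matrix.reindex ε ε (fromBlocks (Real.sqrt t • (1 : Matrix (Fin 1 ⊕ Fin 1) (Fin 1 ⊕ Fin 1) ℝ)) 0 0 (B : Matrix _ _ ℝ))) :
    N ∈ mumfordTateGroup (prinPeriod (blockDiagPoint e Z₁ Z₂)) := by
  have hs0 : Real.sqrt t ≠ 0 := (Real.sqrt_pos.2 ht).ne'
  refine reindex_fromBlocks_mem_mumfordTateGroup_prinPeriod_blockDiagPoint_of_not_isCMPoint Z₁ Z₂ e h₁ h₂ h₃ h₄ hn hτ hc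
    (Matrix.GeneralLinearGroup.scalar (Fin 1 ⊕ Fin 1) (Units.mk0 (Real.sqrt t) hs0)) hB ?_ ?_
  · rw [hB', Matrix.GeneralLinearGroup.coe_scalar, Units.val_mk0, Matrix.scalar_apply, ← Matrix.smul_one_eq_diagonal,
      Matrix.det_smul, Matrix.det_one, mul_one, Fintype.card_sum, Fintype.card_fin, Real.sq_sqrt ht.le]
  · rw [hN, Matrix.GeneralLinearGroup.coe_scalar, Units.val_mk0, Matrix.scalar_apply, ← Matrix.smul_one_eq_diagonal]

/-- **ON COMPLEX POINTS: `MT(X_{(τ 0; 0 Z)})(ℂ) = GL₂(ℂ) ×_{det = ν} MT(X_Z)(ℂ)`** (`τ` non-CM, `Hg(X_Z)(ℂ)` commutative, `n ≥ 1`):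
`N ∈ MT(X_{(τ 0; 0 Z)})(ℂ)` iff `N = reindex_ε (A 0; 0 B)` with `A ∈ GL₂(ℂ)` arbitrary, `B ∈ MT(X_Z)(ℂ)` and `ᵗB J B = det(A) · J`.
[cite: MoonenZarhin1999LowDim, §3 Theorem (2) (p0006 L70–L76)] [cite: CarlsonMullerStachPeters2017, §15.2 Examples 15.2.4 (ii)]
[cite: Moonen2004MT, §5 (5.2) and (5.6) Exercise] -/
theorem mem_mumfordTateGroupC_prinPeriod_blockDiagPoint_iff_of_not_isCMPoint
    (h₁ : ∀ i, ε (Sum.inl (Sum.inl i)) = Sum.inl (e (Sum.inl i))) (h₂ : ∀ i, ε (Sum.inl (Sum.inr i)) = Sum.inr (e (Sum.inl i)))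
    (h₃ : ∀ j, ε (Sum.inr (Sum.inl j)) = Sum.inl (e (Sum.inr j))) (h₄ : ∀ j, ε (Sum.inr (Sum.inr j)) = Sum.inr (e (Sum.inr j)))
    (hn : 0 < n) (hτ : ¬ IsCMPoint Z₁)
    (hc : ∀ M ∈ hodgeGroupC (prinPeriod Z₂), ∀ N ∈ hodgeGroupC (prinPeriod Z₂), M * N = N * M)
    {N : GL (Fin g ⊕ Fin g) ℂ} :
    N ∈ mumfordTateGroupC (prinPeriod (blockDiagPoint e Z₁ Z₂)) ↔
      ∃ A : GL (Fin 1 ⊕ Fin 1) ℂ, ∃ B ∈ mumfordTateGroupC (prinPeriod Z₂),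
        (B : Matrix (Fin n ⊕ Fin n) (Fin n ⊕ Fin n) ℂ)ᵀ * Matrix.J (Fin n) ℂ * B =
            (A : Matrix (Fin 1 ⊕ Fin 1) (Fin 1 ⊕ Fin 1) ℂ).det • Matrix.J (Fin n) ℂ ∧
          (N : Matrix (Fin g ⊕ Fin g) (Fin g ⊕ Fin g) ℂ) =
            Matrix.reindex ε ε (fromBlocks (A : Matrix _ _ ℂ) 0 0 (B : Matrix _ _ ℂ)) := by
  rw [mem_mumfordTateGroupC_prinPeriod_blockDiagPoint_iff_of_hodgeGroup_prod_eq e Z₁ Z₂ h₁ h₂ h₃ h₄ one_pos hn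
    (hodgeGroup_prod_prinPeriod_one_eq_of_not_isCMPoint Z₁ Z₂ hτ hc),
    mumfordTateGroupC_prinPeriod_one_eq_top_of_not_isCMPoint hτ]
  constructor
  · rintro ⟨A, -, B, hB, c, hcA, hcB, hNAB⟩
    refine ⟨A, B, hB, ?_, hNAB⟩
    rw [transpose_mul_J_mul_fin_one] at hcA
    have hc' : (A : Matrix (Fin 1 ⊕ Fin 1) (Fin 1 ⊕ Fin 1) ℂ).det = c := by
      have h10 := congrFun (congrFun hcA (Sum.inr 0)) (Sum.inl 0)
      simpa [Matrix.J] using h10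
    rw [hcB, hc']
  · rintro ⟨A, B, hB, hB', hNAB⟩
    exact ⟨A, Subgroup.mem_top A, B, hB, (A : Matrix (Fin 1 ⊕ Fin 1) (Fin 1 ⊕ Fin 1) ℂ).det,
      transpose_mul_J_mul_fin_one _, hB', hNAB⟩

end EllipticBlock

end SiegelModuli

end Literature.AlgebraicGeometry.ModuliOfAbelianVarieties
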